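import Literature.NumberTheory.Rogawski1990.LocalNormFibreBadFrameClassesCM       -- ★ (CNT-a) FILE 2 F0P3a-p08: the three arrows (→), (wd)/(inj), (←)
import Literature.NumberTheory.Rogawski1990.LocalStableClassesNonsplitKappa     -- ★ `isLocalNormPair_of_conj_eq`
import HarnessLib

/-!
# The matched classes realised in the bad frame are COUNTED by the unitary blocks: `#{Q′-side classes of G′_v matched with γ_H} = #{U(G₁′)-classes with χ = χ_{γ_H.1}}`
# and the two sets are finite together (Rogawski 1990, §8.1 Prop. 8.1.3 pp. 110–111) — (CNT-a) FILE 3, the `ConjClasses` ∕ `ncard` ∕ `Finite` packaging of `hcnt`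

Topic `NumberTheory/Rogawski1990`; namespace `Literature.NumberTheory.Rogawski1990`.  THEOREMS ONLY (no definition, no instance, no notation, no named fact, no `sorry`).
Cell `pub/hodgecm-mathlib` (D-0151), crux H413 = stmt-HodgeConjecture-24833, floor-2 line «N6nsGerm», binder `hcnt` of ★ `exists_nhds_finsum_side_eq_stableOrbitalIntegralRel_of_compact_dock`
(B-p08 (g27), p842024) with `Q′ γH g := ∃ B, g·P′ = P′·(B ⊕ᶠ γH.2)`; brick **(CNT-a) FILE 3** (LEAD F0P3a-plan (g9) T8-118); seat F0P3a-p08 (g13).  HONEST LABEL: HC_CM is proved only modulo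
the printed citations until rung 0 closes; unconditional local algebra + finite bookkeeping.

THE MATHEMATICS.  For `γ_H` `G`-regular and the bad frame `P′` (`ᵗ(σP′)H′_vP′ = G₁′ ⊕ᶠ G₂′`), the map «class `c` of `G′_v` with a representative `xγx⁻¹ = P′(B ⊕ᶠ u)P′⁻¹` matched with
`γ_H` ↦ `U(G₁′)`-class of `B`» is well defined and injective (★ FILE 2 (wd)∕(inj)) and surjective onto the classes with `χ_B = χ_{γ_H.1}` (★ FILE 2 (→)∕(←)).  Hence
`{c | (∃ x, Q′ γH (x·out c·x⁻¹)) ∧ γ_H ↔ out c}.ncard = {β : ConjClasses U(G₁′) | χ_{out β} = χ_{γ_H.1}}.ncard` and either set is finite iff the other is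
(`finite_iff_and_ncard_eq_matched_badFrame`).  What remains of `hcnt` for the (CNT-b) hand: the COUNT `#{β | χ_{out β} = χ} = #{U₂-classes stably conjugate to γ_H.1}` in the
compact `U(G₁′)` (elliptic case) and `= 0` for non-elliptic `γ_H.1`.

## References
* [Rogawski1990] J. D. Rogawski, *Automorphic Representations of Unitary Groups in Three Variables*, Ann. of Math. Stud. 123 (1990): §8.1 Prop. 8.1.3 pp. 110–111; §3.8 Prop. 3.8.1 (d) p. 30.
-/

set_option autoImplicit false

noncomputable section

open NumberField IsDedekindDomain Matrix Polynomial
open scoped MatrixGroups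

namespace Literature.NumberTheory.Rogawski1990

open Literature.NumberTheory.Automorphic Literature.NumberTheory.Automorphic.UnitaryGroup
open Literature.AlgebraicGeometry.ShimuraVarieties (unitaryGroup mem_unitaryGroup_iff)

section CM

variable (L : Type) [Field L] [NumberField L] [IsCMField L] (H' : Matrix (Fin 3) (Fin 3) L) (v : HeightOneSpectrum (𝓞 ↥(maximalRealSubfield L)))

/-- A unitary block as an element of `U(G₁′)`: a matrix `B` with `ᵗ(σB)G₁′B = G₁′` and `det B` a unit defines `⟨B⟩ ∈ U(G₁′) ≤ GL₂(E_v)`. [cite: Rogawski1990, §8.1 Prop. 8.1.3 p. 110] -/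
theorem exists_mem_unitaryGroup_coe_eq {G₁' B : Matrix (Fin 2) (Fin 2) (LocalRing L v)}
    (hB : twistGram (conjLocal L (IsCMField.complexConj L) v) G₁' B = G₁') (hBd : IsUnit B.det) :
    ∃ u : ↥(unitaryGroup (conjLocal L (IsCMField.complexConj L) v) G₁'), ((u.val : GL (Fin 2) (LocalRing L v)).val : Matrix (Fin 2) (Fin 2) (LocalRing L v)) = B := by
  refine ⟨⟨Matrix.nonsingInvUnit B hBd, (twistGram_coe_eq_iff_mem_unitaryGroup _ G₁' _).1 ?_⟩, rfl⟩
  exact hB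

/-- Conjugate unitary blocks: `k₁ ∈ U(G₁′)` invertible with `k₁B = B₂k₁` conjugates `⟨B⟩` to `⟨B₂⟩` inside `U(G₁′)`. [cite: Rogawski1990, §8.1 Prop. 8.1.3 p. 110] -/
theorem mk_eq_mk_of_unitary_block_conj {G₁' : Matrix (Fin 2) (Fin 2) (LocalRing L v)}
    {u u₂ : ↥(unitaryGroup (conjLocal L (IsCMField.complexConj L) v) G₁')} {k₁ : Matrix (Fin 2) (Fin 2) (LocalRing L v)}
    (hk₁ : twistGram (conjLocal L (IsCMField.complexConj L) v) G₁' k₁ = G₁') (hk₁d : IsUnit k₁.det)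
    (hkB : k₁ * ((u.val : GL (Fin 2) (LocalRing L v)).val : Matrix (Fin 2) (Fin 2) (LocalRing L v)) = ((u₂.val : GL (Fin 2) (LocalRing L v)).val : Matrix (Fin 2) (Fin 2) (LocalRing L v)) * k₁) :
    ConjClasses.mk u₂ = ConjClasses.mk u := by
  obtain ⟨k, hk⟩ := exists_mem_unitaryGroup_coe_eq L v hk₁ hk₁d
  have hval : (k.val : GL (Fin 2) (LocalRing L v)) * u.val = u₂.val * k.val :=
    Units.ext (by rw [Units.val_mul, Units.val_mul, hk]; exact hkB)
  have hku : k * u = u₂ * k := Subtype.ext hval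
  have hc : k * u * k⁻¹ = u₂ := by rw [hku, mul_inv_cancel_right]
  exact (ConjClasses.mk_eq_mk_iff_isConj.2 (isConj_iff.2 ⟨k, hc⟩)).symm

/-- Transport of finiteness and `ncard` along a map that is injective on `S` and maps `S` onto `C`. [folklore] -/
private theorem finite_iff_and_ncard_eq_of_maps {α β : Type*} {S : Set α} {C : Set β} (f : α → β) (hfC : ∀ a ∈ S, f a ∈ C)
    (hinj : ∀ a ∈ S, ∀ a' ∈ S, f a = f a' → a = a') (hsurj : ∀ b ∈ C, ∃ a ∈ S, f a = b) : (S.Finite ↔ C.Finite) ∧ S.ncard = C.ncard := by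
  refine ⟨⟨fun hSf => ?_, fun hCf => ?_⟩, Set.ncard_congr (fun a _ => f a) hfC (fun a b ha hb h => hinj a ha b hb h) (fun b hb => by obtain ⟨a, ha, hab⟩ := hsurj b hb; exact ⟨a, ha, hab⟩)⟩
  · haveI := hSf.to_subtype
    refine (Set.finite_range fun p : ↥S => f p.1).subset ?_
    intro b hb
    obtain ⟨a, ha, hab⟩ := hsurj b hb
    exact ⟨⟨a, ha⟩, hab⟩
  · haveI := hCf.to_subtype
    have hinj' : Function.Injective fun p : ↥S => (⟨f p.1, hfC p.1 p.2⟩ : ↥C) := by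
      intro p q h
      exact Subtype.ext (hinj p.1 p.2 q.1 q.2 (congrArg Subtype.val h))
    exact Set.finite_coe_iff.1 (Finite.of_injective _ hinj')

/-- charpoly is a class function on `U(G₁′)`. [folklore] -/
private theorem charpoly_eq_of_mk_eq_mk {G₁' : Matrix (Fin 2) (Fin 2) (LocalRing L v)} (u u' : ↥(unitaryGroup (conjLocal L (IsCMField.complexConj L) v) G₁')) (h : ConjClasses.mk u = ConjClasses.mk u') :
    ((u.val : GL (Fin 2) (LocalRing L v)).val : Matrix (Fin 2) (Fin 2) (LocalRing L v)).charpoly = ((u'.val : GL (Fin 2) (LocalRing L v)).val : Matrix (Fin 2) (Fin 2) (LocalRing L v)).charpoly := by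
  rw [ConjClasses.mk_eq_mk_iff_isConj] at h
  obtain ⟨k, hk⟩ := isConj_iff.1 h
  have hk' : (k.val : GL (Fin 2) (LocalRing L v)) * u.val * (k.val)⁻¹ = u'.val := by
    rw [← hk]; rfl
  rw [← hk', Units.val_mul, Units.val_mul, Matrix.coe_units_inv, Matrix.charpoly_units_conj]

/-- The forward map of the count: a `Q′`-realised matched class determines ONE `U(G₁′)`-class of blocks, with `χ = χ_{γ_H.1}`. [cite: Rogawski1990, §8.1 Prop. 8.1.3 p. 110] -/
private theorem exists_block_class_of_matched
    {P' : GL (Fin (2 + 1)) (LocalRing L v)} {G₁' : Matrix (Fin 2) (Fin 2) (LocalRing L v)} {G₂' : Matrix (Fin 1) (Fin 1) (LocalRing L v)}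
    (hP' : twistGram (conjLocal L (IsCMField.complexConj L) v) ((adelicForm L 3 H').map (adeleToLocal L v)) P'.val = finSum 2 1 G₁' G₂')
    {γH : ((cmDatum L 2 (Matrix.of fun i j : Fin 2 => if i.val + j.val + 1 = 2 then (1 : L) else 0)).Local v ×
      (cmDatum L 1 (Matrix.of fun i j : Fin 1 => if i.val + j.val + 1 = 1 then (1 : L) else 0)).Local v)} (hreg : IsLocalGRegular L v γH)
    (c : ConjClasses ((cmDatum L 3 H').Local v)) (hc : ((∃ x : (cmDatum L 3 H').Local v, ∃ B : Matrix (Fin 2) (Fin 2) (LocalRing L v),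
          ((x * Quotient.out c * x⁻¹).val.val : Matrix (Fin 3) (Fin 3) (LocalRing L v)) * P'.val = P'.val * finSum 2 1 B (γH.2.val.val : Matrix (Fin 1) (Fin 1) (LocalRing L v))) ∧
        IsLocalNormPair L H' v γH (Quotient.out c))) :
    ∃ β : ConjClasses ↥(unitaryGroup (conjLocal L (IsCMField.complexConj L) v) G₁'), (((Quotient.out β : ↥(unitaryGroup (conjLocal L (IsCMField.complexConj L) v) G₁')).val : GL (Fin 2) (LocalRing L v)).val : Matrix (Fin 2) (Fin 2) (LocalRing L v)).charpoly =
          finCharpolyTwo L v γH ∧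
        ∀ (x : (cmDatum L 3 H').Local v) (B : Matrix (Fin 2) (Fin 2) (LocalRing L v)),
          ((x * Quotient.out c * x⁻¹).val.val : Matrix (Fin 3) (Fin 3) (LocalRing L v)) * P'.val = P'.val * finSum 2 1 B (γH.2.val.val : Matrix (Fin 1) (Fin 1) (LocalRing L v)) →
          ∀ u : ↥(unitaryGroup (conjLocal L (IsCMField.complexConj L) v) G₁'), ((u.val : GL (Fin 2) (LocalRing L v)).val : Matrix (Fin 2) (Fin 2) (LocalRing L v)) = B →
            ConjClasses.mk u = β := by
  obtain ⟨⟨x, B, hQ⟩, hm⟩ := hc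
  obtain ⟨hBu, hBd, hχ⟩ := matched_badFrame_block L H' v hP' γH hm hQ
  obtain ⟨u, hu⟩ := exists_mem_unitaryGroup_coe_eq L v hBu hBd
  refine ⟨ConjClasses.mk u, ?_, ?_⟩
  · rw [charpoly_eq_of_mk_eq_mk L v _ u (Quotient.out_eq _), hu, hχ]
  · intro x' B' hQ' u' hu'
    obtain ⟨k₁, hk₁, hk₁d, hkB⟩ := exists_unitary_block_conj_of_matched_badFrame L H' v hP' hreg hm hm (g := 1) (by group) hQ hQ'
    rw [← hu, ← hu'] at hkB
    exact mk_eq_mk_of_unitary_block_conj L v hk₁ hk₁d hkB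

/-- Injectivity of the forward map. [cite: Rogawski1990, §8.1 Prop. 8.1.3 pp. 110–111] -/
private theorem eq_of_block_class_eq
    {P' : GL (Fin (2 + 1)) (LocalRing L v)} {G₁' : Matrix (Fin 2) (Fin 2) (LocalRing L v)} {G₂' : Matrix (Fin 1) (Fin 1) (LocalRing L v)}
    (hP' : twistGram (conjLocal L (IsCMField.complexConj L) v) ((adelicForm L 3 H').map (adeleToLocal L v)) P'.val = finSum 2 1 G₁' G₂')
    {γH : ((cmDatum L 2 (Matrix.of fun i j : Fin 2 => if i.val + j.val + 1 = 2 then (1 : L) else 0)).Local v ×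
      (cmDatum L 1 (Matrix.of fun i j : Fin 1 => if i.val + j.val + 1 = 1 then (1 : L) else 0)).Local v)}
    (f : ConjClasses ((cmDatum L 3 H').Local v) → ConjClasses ↥(unitaryGroup (conjLocal L (IsCMField.complexConj L) v) G₁'))
    (hfuniq : ∀ c : ConjClasses ((cmDatum L 3 H').Local v), ((∃ x : (cmDatum L 3 H').Local v, ∃ B : Matrix (Fin 2) (Fin 2) (LocalRing L v),
          ((x * Quotient.out c * x⁻¹).val.val : Matrix (Fin 3) (Fin 3) (LocalRing L v)) * P'.val = P'.val * finSum 2 1 B (γH.2.val.val : Matrix (Fin 1) (Fin 1) (LocalRing L v))) ∧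
        IsLocalNormPair L H' v γH (Quotient.out c)) →
        ∀ (x : (cmDatum L 3 H').Local v) (B : Matrix (Fin 2) (Fin 2) (LocalRing L v)),
          ((x * Quotient.out c * x⁻¹).val.val : Matrix (Fin 3) (Fin 3) (LocalRing L v)) * P'.val = P'.val * finSum 2 1 B (γH.2.val.val : Matrix (Fin 1) (Fin 1) (LocalRing L v)) →
          ∀ u : ↥(unitaryGroup (conjLocal L (IsCMField.complexConj L) v) G₁'), ((u.val : GL (Fin 2) (LocalRing L v)).val : Matrix (Fin 2) (Fin 2) (LocalRing L v)) = B →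
            ConjClasses.mk u = f c)
    (c : ConjClasses ((cmDatum L 3 H').Local v)) (hc : ((∃ x : (cmDatum L 3 H').Local v, ∃ B : Matrix (Fin 2) (Fin 2) (LocalRing L v),
          ((x * Quotient.out c * x⁻¹).val.val : Matrix (Fin 3) (Fin 3) (LocalRing L v)) * P'.val = P'.val * finSum 2 1 B (γH.2.val.val : Matrix (Fin 1) (Fin 1) (LocalRing L v))) ∧
        IsLocalNormPair L H' v γH (Quotient.out c)))
    (c' : ConjClasses ((cmDatum L 3 H').Local v)) (hc' : ((∃ x : (cmDatum L 3 H').Local v, ∃ B : Matrix (Fin 2) (Fin 2) (LocalRing L v),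
          ((x * Quotient.out c' * x⁻¹).val.val : Matrix (Fin 3) (Fin 3) (LocalRing L v)) * P'.val = P'.val * finSum 2 1 B (γH.2.val.val : Matrix (Fin 1) (Fin 1) (LocalRing L v))) ∧
        IsLocalNormPair L H' v γH (Quotient.out c'))) (hff : f c = f c') : c = c' := by
  obtain ⟨⟨x, B, hQ⟩, hm⟩ := hc
  obtain ⟨⟨x', B', hQ'⟩, hm'⟩ := hc'
  obtain ⟨hBu, hBd, -⟩ := matched_badFrame_block L H' v hP' γH hm hQ
  obtain ⟨hBu', hBd', -⟩ := matched_badFrame_block L H' v hP' γH hm' hQ'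
  obtain ⟨u, hu⟩ := exists_mem_unitaryGroup_coe_eq L v hBu hBd
  obtain ⟨u', hu'⟩ := exists_mem_unitaryGroup_coe_eq L v hBu' hBd'
  have h1 : ConjClasses.mk u = f c := hfuniq c ⟨⟨x, B, hQ⟩, hm⟩ x B hQ u hu
  have h2 : ConjClasses.mk u' = f c' := hfuniq c' ⟨⟨x', B', hQ'⟩, hm'⟩ x' B' hQ' u' hu'
  have h12 : ConjClasses.mk u = ConjClasses.mk u' := by rw [h1, h2, hff]
  rw [ConjClasses.mk_eq_mk_iff_isConj] at h12
  obtain ⟨k, hk⟩ := isConj_iff.1 h12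
  have hk' : (k.val : GL (Fin 2) (LocalRing L v)) * u.val * (k.val)⁻¹ = u'.val := by
    rw [← hk]; rfl
  have hkB : ((k.val : GL (Fin 2) (LocalRing L v)).val : Matrix (Fin 2) (Fin 2) (LocalRing L v)) * B = B' * (k.val : GL (Fin 2) (LocalRing L v)).val := by
    have e : (k.val : GL (Fin 2) (LocalRing L v)) * u.val = u'.val * k.val := by rw [← hk', inv_mul_cancel_right]
    have e' := congrArg (fun M : GL (Fin 2) (LocalRing L v) => (M.val : Matrix (Fin 2) (Fin 2) (LocalRing L v))) e
    simpa only [Units.val_mul, hu, hu'] using e'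
  have hkU : twistGram (conjLocal L (IsCMField.complexConj L) v) G₁' ((k.val : GL (Fin 2) (LocalRing L v)).val) = G₁' :=
    (twistGram_coe_eq_iff_mem_unitaryGroup _ G₁' _).2 k.2
  obtain ⟨g, hg⟩ := exists_conj_of_unitary_block_conj L H' v hP' γH hQ hQ' hkU (Matrix.isUnits_det_units _) hkB
  calc c = ConjClasses.mk (Quotient.out c) := (Quotient.out_eq _).symm
    _ = ConjClasses.mk (Quotient.out c') := by rw [ConjClasses.mk_eq_mk_iff_isConj]; exact isConj_iff.2 ⟨g, hg⟩
    _ = c' := Quotient.out_eq _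

/-- Surjectivity of the forward map onto the classes with `χ = χ_{γ_H.1}`. [cite: Rogawski1990, §8.1 Prop. 8.1.3 pp. 110–111] -/
private theorem exists_matched_class_of_block_class (w : PlacesOver L v) (hw : IsCMField.complexConj L • w.1 = w.1)
    {P' : GL (Fin (2 + 1)) (LocalRing L v)} {G₁' : Matrix (Fin 2) (Fin 2) (LocalRing L v)} {G₂' : Matrix (Fin 1) (Fin 1) (LocalRing L v)}
    (hP' : twistGram (conjLocal L (IsCMField.complexConj L) v) ((adelicForm L 3 H').map (adeleToLocal L v)) P'.val = finSum 2 1 G₁' G₂')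
    {γH : ((cmDatum L 2 (Matrix.of fun i j : Fin 2 => if i.val + j.val + 1 = 2 then (1 : L) else 0)).Local v ×
      (cmDatum L 1 (Matrix.of fun i j : Fin 1 => if i.val + j.val + 1 = 1 then (1 : L) else 0)).Local v)} (hreg : IsLocalGRegular L v γH)
    (f : ConjClasses ((cmDatum L 3 H').Local v) → ConjClasses ↥(unitaryGroup (conjLocal L (IsCMField.complexConj L) v) G₁'))
    (hfuniq : ∀ c : ConjClasses ((cmDatum L 3 H').Local v), ((∃ x : (cmDatum L 3 H').Local v, ∃ B : Matrix (Fin 2) (Fin 2) (LocalRing L v),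
          ((x * Quotient.out c * x⁻¹).val.val : Matrix (Fin 3) (Fin 3) (LocalRing L v)) * P'.val = P'.val * finSum 2 1 B (γH.2.val.val : Matrix (Fin 1) (Fin 1) (LocalRing L v))) ∧
        IsLocalNormPair L H' v γH (Quotient.out c)) →
        ∀ (x : (cmDatum L 3 H').Local v) (B : Matrix (Fin 2) (Fin 2) (LocalRing L v)),
          ((x * Quotient.out c * x⁻¹).val.val : Matrix (Fin 3) (Fin 3) (LocalRing L v)) * P'.val = P'.val * finSum 2 1 B (γH.2.val.val : Matrix (Fin 1) (Fin 1) (LocalRing L v)) →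
          ∀ u : ↥(unitaryGroup (conjLocal L (IsCMField.complexConj L) v) G₁'), ((u.val : GL (Fin 2) (LocalRing L v)).val : Matrix (Fin 2) (Fin 2) (LocalRing L v)) = B →
            ConjClasses.mk u = f c)
    (β : ConjClasses ↥(unitaryGroup (conjLocal L (IsCMField.complexConj L) v) G₁')) (hβ : (((Quotient.out β : ↥(unitaryGroup (conjLocal L (IsCMField.complexConj L) v) G₁')).val : GL (Fin 2) (LocalRing L v)).val : Matrix (Fin 2) (Fin 2) (LocalRing L v)).charpoly =
          finCharpolyTwo L v γH) :
    ∃ c : ConjClasses ((cmDatum L 3 H').Local v), ((∃ x : (cmDatum L 3 H').Local v, ∃ B : Matrix (Fin 2) (Fin 2) (LocalRing L v),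
          ((x * Quotient.out c * x⁻¹).val.val : Matrix (Fin 3) (Fin 3) (LocalRing L v)) * P'.val = P'.val * finSum 2 1 B (γH.2.val.val : Matrix (Fin 1) (Fin 1) (LocalRing L v))) ∧
        IsLocalNormPair L H' v γH (Quotient.out c)) ∧ f c = β := by
  obtain ⟨u₀, hu₀⟩ : ∃ u₀ : ↥(unitaryGroup (conjLocal L (IsCMField.complexConj L) v) G₁'), u₀ = Quotient.out β := ⟨_, rfl⟩
  have hβ' : (((u₀.val : GL (Fin 2) (LocalRing L v)).val : Matrix (Fin 2) (Fin 2) (LocalRing L v))).charpoly = finCharpolyTwo L v γH := by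
    rw [hu₀]; exact hβ
  have hBu : twistGram (conjLocal L (IsCMField.complexConj L) v) G₁' ((u₀.val : GL (Fin 2) (LocalRing L v)).val) = G₁' :=
    (twistGram_coe_eq_iff_mem_unitaryGroup _ G₁' _).2 u₀.2
  have hBd : IsUnit ((u₀.val : GL (Fin 2) (LocalRing L v)).val : Matrix (Fin 2) (Fin 2) (LocalRing L v)).det := Matrix.isUnits_det_units _
  obtain ⟨γ', hm, hQ⟩ := exists_matched_of_unitary_block L H' v w hw hP' hreg (B := ((u₀.val : GL (Fin 2) (LocalRing L v)).val : Matrix (Fin 2) (Fin 2) (LocalRing L v))) hBu hBd hβ'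
  -- `c₀ := ⟦γ′⟧` and `γ₀ := out c₀` (kept opaque): `γ₀ = g γ′ g⁻¹`, realised with `x := g⁻¹`
  obtain ⟨c₀, hc₀⟩ : ∃ c₀ : ConjClasses ((cmDatum L 3 H').Local v), ConjClasses.mk γ' = c₀ := ⟨_, rfl⟩
  obtain ⟨γ₀, hγ₀⟩ : ∃ γ₀ : (cmDatum L 3 H').Local v, Quotient.out c₀ = γ₀ := ⟨_, rfl⟩
  obtain ⟨g, hg⟩ : ∃ g : (cmDatum L 3 H').Local v, g * γ' * g⁻¹ = γ₀ := by
    have h : IsConj γ' γ₀ := by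
      rw [← hγ₀]
      exact ConjClasses.mk_eq_mk_iff_isConj.1 (by rw [hc₀]; exact (Quotient.out_eq c₀).symm)
    exact isConj_iff.1 h
  have hQc : ((g⁻¹ * γ₀ * (g⁻¹)⁻¹).val.val : Matrix (Fin 3) (Fin 3) (LocalRing L v)) * P'.val =
      P'.val * finSum 2 1 ((u₀.val : GL (Fin 2) (LocalRing L v)).val) (γH.2.val.val : Matrix (Fin 1) (Fin 1) (LocalRing L v)) := by
    have e : g⁻¹ * γ₀ * (g⁻¹)⁻¹ = γ' := by rw [← hg]; group
    rw [e]; exact hQ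
  have e₁ : g.val * γ'.val * (g.val)⁻¹ = γ₀.val := by rw [← hg]; rfl
  have hmc : IsLocalNormPair L H' v γH γ₀ := isLocalNormPair_of_conj_eq L v H' γH γ' γ₀ hm (g := g.val) e₁
  subst hγ₀
  have hPc : ((∃ x : (cmDatum L 3 H').Local v, ∃ B : Matrix (Fin 2) (Fin 2) (LocalRing L v),
          ((x * Quotient.out c₀ * x⁻¹).val.val : Matrix (Fin 3) (Fin 3) (LocalRing L v)) * P'.val = P'.val * finSum 2 1 B (γH.2.val.val : Matrix (Fin 1) (Fin 1) (LocalRing L v))) ∧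
        IsLocalNormPair L H' v γH (Quotient.out c₀)) := ⟨⟨g⁻¹, _, hQc⟩, hmc⟩
  have hfin : ConjClasses.mk u₀ = f c₀ :=
    hfuniq c₀ hPc (g⁻¹) (((u₀.val : GL (Fin 2) (LocalRing L v)).val : Matrix (Fin 2) (Fin 2) (LocalRing L v))) hQc u₀ rfl
  refine ⟨c₀, hPc, ?_⟩
  rw [← hfin, hu₀]
  exact Quotient.out_eq _

/-- **THE COUNT OF `hcnt`, FRAME HALF.**  `γ_H` `G`-regular, `P′` the bad frame: the set of conjugacy classes `c` of `G′_v` having a representative realised in the frame `P′` with second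
block `γ_H.2` and matched with `γ_H` is FINITE iff the set of `U(G₁′)`-classes `β` with `χ_{out β} = χ_{γ_H.1}` is, and the two have the same `ncard`.
[cite: Rogawski1990, §8.1 Prop. 8.1.3 pp. 110–111; §3.8 Prop. 3.8.1 (d) p. 30] -/
theorem finite_iff_and_ncard_eq_matched_badFrame (w : PlacesOver L v) (hw : IsCMField.complexConj L • w.1 = w.1)
    {P' : GL (Fin (2 + 1)) (LocalRing L v)} {G₁' : Matrix (Fin 2) (Fin 2) (LocalRing L v)} {G₂' : Matrix (Fin 1) (Fin 1) (LocalRing L v)}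
    (hP' : twistGram (conjLocal L (IsCMField.complexConj L) v) ((adelicForm L 3 H').map (adeleToLocal L v)) P'.val = finSum 2 1 G₁' G₂')
    {γH : ((cmDatum L 2 (Matrix.of fun i j : Fin 2 => if i.val + j.val + 1 = 2 then (1 : L) else 0)).Local v ×
      (cmDatum L 1 (Matrix.of fun i j : Fin 1 => if i.val + j.val + 1 = 1 then (1 : L) else 0)).Local v)} (hreg : IsLocalGRegular L v γH) :
    ({c : ConjClasses ((cmDatum L 3 H').Local v) |
        (∃ x : (cmDatum L 3 H').Local v, ∃ B : Matrix (Fin 2) (Fin 2) (LocalRing L v),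
          ((x * Quotient.out c * x⁻¹).val.val : Matrix (Fin 3) (Fin 3) (LocalRing L v)) * P'.val = P'.val * finSum 2 1 B (γH.2.val.val : Matrix (Fin 1) (Fin 1) (LocalRing L v))) ∧
        IsLocalNormPair L H' v γH (Quotient.out c)}.Finite ↔
      {β : ConjClasses ↥(unitaryGroup (conjLocal L (IsCMField.complexConj L) v) G₁') |
        (((Quotient.out β : ↥(unitaryGroup (conjLocal L (IsCMField.complexConj L) v) G₁')).val : GL (Fin 2) (LocalRing L v)).val : Matrix (Fin 2) (Fin 2) (LocalRing L v)).charpoly =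
          finCharpolyTwo L v γH}.Finite) ∧
    {c : ConjClasses ((cmDatum L 3 H').Local v) |
        (∃ x : (cmDatum L 3 H').Local v, ∃ B : Matrix (Fin 2) (Fin 2) (LocalRing L v),
          ((x * Quotient.out c * x⁻¹).val.val : Matrix (Fin 3) (Fin 3) (LocalRing L v)) * P'.val = P'.val * finSum 2 1 B (γH.2.val.val : Matrix (Fin 1) (Fin 1) (LocalRing L v))) ∧
        IsLocalNormPair L H' v γH (Quotient.out c)}.ncard =
      {β : ConjClasses ↥(unitaryGroup (conjLocal L (IsCMField.complexConj L) v) G₁') |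
        (((Quotient.out β : ↥(unitaryGroup (conjLocal L (IsCMField.complexConj L) v) G₁')).val : GL (Fin 2) (LocalRing L v)).val : Matrix (Fin 2) (Fin 2) (LocalRing L v)).charpoly =
          finCharpolyTwo L v γH}.ncard := by
  classical
  choose! f hfC hfuniq using exists_block_class_of_matched L H' v hP' hreg
  exact finite_iff_and_ncard_eq_of_maps f hfC (eq_of_block_class_eq L H' v hP' f hfuniq)
    (exists_matched_class_of_block_class L H' v w hw hP' hreg f hfuniq)

end CM

end Literature.NumberTheory.Rogawski1990

end
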